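import Summits.AtomisticToContinuum.Crystallization.Theorems.FrustratedLawDichotomyStrainedPatchTaylorTop

/-!
# Strained patch — THE TAYLOR CHARGE: the quadratic-price law reduced to per-bond calculus and a far column
# (decomp-a2c lens-5 «finite/base range + asymptotic regime + bridge», generation 73; crux `AperiodicFrustratedLawGap`, stmt-AtomisticToContinuum-27623)

T-side record (critic row 1198): `[CORE-FAR] CoreOffTubeFloor (63/10) (63/10) (24/5) (1/100) 0 ⟸ coreOff_of_quadPrice_descent :
FamilyCover ∧ PricedCharge 𝓘 τ (quadPrice B T r) X ∧ PriceTop ∧ PriceSteps ∧ SlackCert`.  This module DISCHARGES the one KNOWN-MATH leaf of that line,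
the state-dependent remainder law `PricedCharge 𝓘 τ (quadPrice B T r) X`, to

* **(C2L) `BondHessLip B L s₀ r m`** [KNOWN-MATH · per-bond calculus of ONE explicit map `E3 → E3`]: on the bond shell `s₀ ≤ ‖q‖ < r`, along every segment
  `[q, q + Δ]` with `‖Δ‖ ≤ m`, the LJ bond force `f(x) = (V'(‖x‖)/‖x‖)·x` has derivative the tree's `pairHess`, `pairHess` has derivative `B`, and `B` moves by at
  most `L(‖q‖)·‖y − q‖` — the census tabulates `L`, a prover closes it by differentiating a rational map;
* **(SEP) `HostSep 𝓘 s₀`** [decidable on the finite host list]: distinct sites of every instance are `≥ s₀` apart;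
* **(FAR) `FarColumn 𝓘 τ r X`** [INSTRUMENTABLE — the census's slack column X₃ «partners beyond r + uncapped»]: the part of the true-minus-linearised row force NOT
  carried by the charted near bonds (exterior of the charted ball, host partners at distance `≥ r`, cut-off shell mismatch) is `≤ X(z₀)(e a)`;

through two PROVED seams: the generic SHARP second-order Taylor estimate along a segment (constant `1/6`, vector-valued, from Mathlib's boundary-ODE fencing
lemma applied twice — Mathlib's `taylor_mean_remainder_bound` only gives `1/2`) and the finite-sum bookkeeping `‖Σ near‖ ≤ ‖½ Σ B[Δ,Δ]‖ + Σ tails`.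
The tail table of record is therefore the CLOSED FORM `cubicTail L (s, μ) = L(s)·μ³/6`.

No `sorry`, no new axioms, zero edits to landed declarations.
-/

namespace Summit.AtomisticToContinuum.Crystallization.Theorems.FrustratedLawDichotomyStrainedPatchTaylorCharge

open scoped BigOperators Classical RealInnerProductSpace
open Set
open Summit.AtomisticToContinuum.Crystallization.Theorems.FrustratedLawDichotomyMotifLemmas
open Summit.AtomisticToContinuum.Crystallization.Theorems.FrustratedLawDichotomyAveragingCut
open Summit.AtomisticToContinuum.Crystallization.Theorems.FrustratedLawDichotomyStrainedPatchHomSplit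
open Summit.AtomisticToContinuum.Crystallization.Theorems.FrustratedLawDichotomyStrainedPatchCleanCollar
open Summit.AtomisticToContinuum.Crystallization.Theorems.FrustratedLawDichotomyStrainedPatchPhaseCut
open Summit.AtomisticToContinuum.Crystallization.Theorems.FrustratedLawDichotomyStrainedPatchCoreTube
open Summit.AtomisticToContinuum.Crystallization.Theorems.FrustratedLawDichotomyStrainedPatchStrainBands
open Summit.AtomisticToContinuum.Crystallization.Theorems.FrustratedLawDichotomyStrainedPatchHomIsometry
open Summit.AtomisticToContinuum.Crystallization.Theorems.FrustratedLawDichotomyStrainedPatchHomTubeIso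
open Summit.AtomisticToContinuum.Crystallization.Theorems.FrustratedLawDichotomyStrainedPatchEnvelopeLaw
open Summit.AtomisticToContinuum.Crystallization.Theorems.FrustratedLawDichotomyStrainedPatchEnvelopeTaylor
open Summit.AtomisticToContinuum.Crystallization.Theorems.FrustratedLawDichotomyStrainedPatchChartFamilies
open Summit.AtomisticToContinuum.Crystallization.Theorems.FrustratedLawDichotomyStrainedPatchChartFamiliesPinned
open Summit.AtomisticToContinuum.Crystallization.Theorems.FrustratedLawDichotomyStrainedPatchQuantSlaving
open Summit.AtomisticToContinuum.Crystallization.Theorems.FrustratedLawDichotomyStrainedPatchHostCells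
open Summit.AtomisticToContinuum.Crystallization.Theorems.FrustratedLawDichotomyStrainedPatchForceCap
open Summit.AtomisticToContinuum.Crystallization.Theorems.FrustratedLawDichotomyStrainedPatchTextureFloor
open Summit.AtomisticToContinuum.Crystallization.Theorems.FrustratedLawDichotomyStrainedPatchSVCharge
open Summit.AtomisticToContinuum.Crystallization.Theorems.FrustratedLawDichotomyStrainedPatchChargePrice
open Summit.AtomisticToContinuum.Crystallization.Theorems.FrustratedLawDichotomyStrainedPatchTaylorTop

/-! ## §1. The sharp second-order Taylor estimate along a segment (constant `1/6`) -/

section Taylor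

variable {V W : Type*} [NormedAddCommGroup V] [NormedSpace ℝ V] [NormedAddCommGroup W] [NormedSpace ℝ W]

/-- First fence: if `g₁' = g₂` on `[0,1]` and `‖g₂ t − g₂ 0‖ ≤ K·t`, then `‖g₁ t − g₁ 0 − t·g₂ 0‖ ≤ (K/2)·t²`. [elementary, Mathlib fencing lemma] -/
theorem norm_sub_sub_smul_le_of_hasDerivAt {g₁ g₂ : ℝ → W} {K : ℝ} (h₁ : ∀ t ∈ Icc (0 : ℝ) 1, HasDerivAt g₁ (g₂ t) t)
    (hK : ∀ t ∈ Ico (0 : ℝ) 1, ‖g₂ t - g₂ 0‖ ≤ K * t) : ∀ ⦃t : ℝ⦄, t ∈ Icc (0 : ℝ) 1 → ‖g₁ t - g₁ 0 - t • g₂ 0‖ ≤ K / 2 * (t * t) := by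
  have hcont : ContinuousOn (fun t : ℝ => g₁ t - g₁ 0 - t • g₂ 0) (Icc 0 1) := by
    have hc : ContinuousOn g₁ (Icc 0 1) := fun t ht => (h₁ t ht).continuousAt.continuousWithinAt
    exact (hc.sub continuousOn_const).sub (continuousOn_id.smul continuousOn_const)
  have hder : ∀ t ∈ Ico (0 : ℝ) 1, HasDerivWithinAt (fun t : ℝ => g₁ t - g₁ 0 - t • g₂ 0) (g₂ t - g₂ 0) (Ici t) t := by
    intro t ht
    have h := ((h₁ t (Ico_subset_Icc_self ht)).sub_const (g₁ 0)).sub ((hasDerivAt_id t).smul_const (g₂ 0))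
    simp only [id, one_smul] at h
    exact h.hasDerivWithinAt
  have hB : ∀ t : ℝ, HasDerivAt (fun t : ℝ => K / 2 * (t * t)) (K * t) t := fun t =>
    (((hasDerivAt_id t).mul (hasDerivAt_id t)).const_mul (K / 2)).congr_deriv (by simp only [id]; ring)
  have h0 : ‖g₁ 0 - g₁ 0 - (0 : ℝ) • g₂ 0‖ ≤ K / 2 * (0 * 0) := by simp
  exact image_norm_le_of_norm_deriv_right_le_deriv_boundary hcont hder h0 hB hK

/-- ★ **SHARP SECOND-ORDER TAYLOR ESTIMATE ON `[0,1]`** (vector-valued): if `g' = g₁`, `g₁' = g₂` on `[0,1]` and `‖g₂ t − g₂ 0‖ ≤ K·t` on `[0,1)`, then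
`‖g 1 − g 0 − g₁ 0 − ½·g₂ 0‖ ≤ K/6`.  (Second fence, with the first fence as the derivative bound.) [elementary] -/
theorem norm_taylor_two_le_of_hasDerivAt {g g₁ g₂ : ℝ → W} {K : ℝ} (h : ∀ t ∈ Icc (0 : ℝ) 1, HasDerivAt g (g₁ t) t)
    (h₁ : ∀ t ∈ Icc (0 : ℝ) 1, HasDerivAt g₁ (g₂ t) t) (hK : ∀ t ∈ Ico (0 : ℝ) 1, ‖g₂ t - g₂ 0‖ ≤ K * t) :
    ‖g 1 - g 0 - g₁ 0 - (1 / 2 : ℝ) • g₂ 0‖ ≤ K / 6 := by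
  have hcont : ContinuousOn (fun t : ℝ => g t - g 0 - t • g₁ 0 - (t * t / 2) • g₂ 0) (Icc 0 1) := by
    have hc : ContinuousOn g (Icc 0 1) := fun t ht => (h t ht).continuousAt.continuousWithinAt
    exact ((hc.sub continuousOn_const).sub (continuousOn_id.smul continuousOn_const)).sub
      (((continuousOn_id.mul continuousOn_id).div_const 2).smul continuousOn_const)
  have hder : ∀ t ∈ Ico (0 : ℝ) 1,
      HasDerivWithinAt (fun t : ℝ => g t - g 0 - t • g₁ 0 - (t * t / 2) • g₂ 0) (g₁ t - g₁ 0 - t • g₂ 0) (Ici t) t := by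
    intro t ht
    have hd := (((h t (Ico_subset_Icc_self ht)).sub_const (g 0)).sub ((hasDerivAt_id t).smul_const (g₁ 0))).sub
      ((((hasDerivAt_id t).mul (hasDerivAt_id t)).div_const 2).smul_const (g₂ 0))
    simp only [id, one_smul] at hd
    rw [show (1 * t + t * 1) / 2 = t by ring] at hd
    exact hd.hasDerivWithinAt
  have hB : ∀ t : ℝ, HasDerivAt (fun t : ℝ => K / 6 * (t * t * t)) (K / 2 * (t * t)) t := fun t =>
    ((((hasDerivAt_id t).mul (hasDerivAt_id t)).mul (hasDerivAt_id t)).const_mul (K / 6)).congr_deriv (by simp only [id, Pi.mul_apply]; ring)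
  have h0 : ‖g 0 - g 0 - (0 : ℝ) • g₁ 0 - ((0 : ℝ) * 0 / 2) • g₂ 0‖ ≤ K / 6 * (0 * 0 * 0) := by simp
  have key := image_norm_le_of_norm_deriv_right_le_deriv_boundary hcont hder h0 hB
    (fun t ht => norm_sub_sub_smul_le_of_hasDerivAt h₁ hK (Ico_subset_Icc_self ht)) (right_mem_Icc.2 zero_le_one)
  have e1 : g 1 - g 0 - (1 : ℝ) • g₁ 0 - ((1 : ℝ) * 1 / 2) • g₂ 0 = g 1 - g 0 - g₁ 0 - (1 / 2 : ℝ) • g₂ 0 := by norm_num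
  rw [e1] at key
  linarith

/-- ★★ **SHARP SECOND-ORDER TAYLOR ESTIMATE ALONG A SEGMENT** for a map `f : V → W` between real normed spaces: if along `[x, x + Δ]` `f` has derivative `f'`,
`f'` has derivative `f''`, and `‖f''(x + tΔ) − f''(x)‖ ≤ L·t·‖Δ‖`, then `‖f(x + Δ) − f(x) − f'(x)Δ − ½ f''(x)ΔΔ‖ ≤ L·‖Δ‖³/6`. [elementary] -/
theorem norm_taylor_two_segment_le {f : V → W} {f' : V → V →L[ℝ] W} {f'' : V → V →L[ℝ] V →L[ℝ] W} {x Δ : V} {L : ℝ}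
    (hf : ∀ t ∈ Icc (0 : ℝ) 1, HasFDerivAt f (f' (x + t • Δ)) (x + t • Δ))
    (hf' : ∀ t ∈ Icc (0 : ℝ) 1, HasFDerivAt f' (f'' (x + t • Δ)) (x + t • Δ))
    (hL : ∀ t ∈ Ico (0 : ℝ) 1, ‖f'' (x + t • Δ) - f'' x‖ ≤ L * (t * ‖Δ‖)) :
    ‖f (x + Δ) - f x - f' x Δ - (1 / 2 : ℝ) • f'' x Δ Δ‖ ≤ L * ‖Δ‖ ^ 3 / 6 := by
  have hc : ∀ t : ℝ, HasDerivAt (fun t : ℝ => x + t • Δ) Δ t := fun t => by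
    simpa using ((hasDerivAt_id t).smul_const Δ).const_add x
  have hg : ∀ t ∈ Icc (0 : ℝ) 1, HasDerivAt (fun t : ℝ => f (x + t • Δ)) (f' (x + t • Δ) Δ) t := fun t ht =>
    (hf t ht).comp_hasDerivAt t (hc t)
  have hg₁ : ∀ t ∈ Icc (0 : ℝ) 1, HasDerivAt (fun t : ℝ => f' (x + t • Δ) Δ) (f'' (x + t • Δ) Δ Δ) t := fun t ht => by
    have h1 : HasDerivAt (fun t : ℝ => f' (x + t • Δ)) (f'' (x + t • Δ) Δ) t := (hf' t ht).comp_hasDerivAt t (hc t)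
    simpa using h1.clm_apply (hasDerivAt_const t Δ)
  have hK : ∀ t ∈ Ico (0 : ℝ) 1, ‖f'' (x + t • Δ) Δ Δ - f'' (x + (0 : ℝ) • Δ) Δ Δ‖ ≤ L * ‖Δ‖ ^ 3 * t := by
    intro t ht
    rw [zero_smul, add_zero, ← sub_apply, ← sub_apply]
    calc ‖(f'' (x + t • Δ) - f'' x) Δ Δ‖ ≤ ‖(f'' (x + t • Δ) - f'' x) Δ‖ * ‖Δ‖ := ContinuousLinearMap.le_opNorm _ _
      _ ≤ ‖f'' (x + t • Δ) - f'' x‖ * ‖Δ‖ * ‖Δ‖ := by gcongr; exact ContinuousLinearMap.le_opNorm _ _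
      _ ≤ L * (t * ‖Δ‖) * ‖Δ‖ * ‖Δ‖ := by gcongr; exact hL t ht
      _ = L * ‖Δ‖ ^ 3 * t := by ring
  have key := norm_taylor_two_le_of_hasDerivAt hg hg₁ hK
  simp only [zero_smul, one_smul, add_zero] at key
  calc ‖f (x + Δ) - f x - f' x Δ - (1 / 2 : ℝ) • f'' x Δ Δ‖ ≤ L * ‖Δ‖ ^ 3 / 6 := by linarith

end Taylor

/-! ## §2. The bond force, the near/far split of a row, the per-bond Taylor law, the far column, and THE SEAM -/

/-- The LJ BOND FORCE: the force felt at a site from one neighbour at relative position `x`, `f(x) = (V'(‖x‖)/‖x‖)·x` (`V = lennardJones`), so that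
`siteForce 7 z a = Σ_{k ∈ moveNbrs 7 z a} f(z k − z a)` (`siteForce_eq_sum_bondForce`); its derivative off the origin is the tree's `pairHess`. -/
noncomputable def bondForce (x : E3) : E3 := (ljD1 ‖x‖ / ‖x‖) • x

/-- `siteForce` is the sum of the bond forces over the move-test neighbourhood. [formal bookkeeping] -/
theorem siteForce_eq_sum_bondForce (Rm : ℝ) {N : ℕ} (y : Fin N → E3) (j : Fin N) :
    siteForce Rm y j = ∑ k ∈ moveNbrs Rm y j, bondForce (y k - y j) := by
  rw [siteForce, ← Finset.sum_neg_distrib]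
  refine Finset.sum_congr rfl fun k _ => ?_
  rw [bondForce, dist_eq_norm, ← norm_neg (y j - y k), neg_sub, ← smul_neg, neg_sub]

/-- `quadPrice`'s NEAR INDEX SET of row `a`: charted-ball sites `b ≠ a` whose host images lie within `r` of the image of `a`. -/
noncomputable def nearSet (r : ℝ) {M : ℕ} (z : Fin M → E3) (c : Fin M) {M₀ : ℕ} (z₀ : Fin M₀ → E3) (e : Fin M → Fin M₀) (a : Fin M) : Finset (Fin M) :=
  (ball (63 / 10) z c).filter (fun b => b ≠ a ∧ dist (z₀ (e b)) (z₀ (e a)) < r)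

/-- Membership in the near set. [formal bookkeeping] -/
theorem mem_nearSet {r : ℝ} {M : ℕ} {z : Fin M → E3} {c : Fin M} {M₀ : ℕ} {z₀ : Fin M₀ → E3} {e : Fin M → Fin M₀} {a b : Fin M} :
    b ∈ nearSet r z c z₀ e a ↔ b ∈ ball (63 / 10) z c ∧ b ≠ a ∧ dist (z₀ (e b)) (z₀ (e a)) < r := by
  simp [nearSet, Finset.mem_filter]

/-- The NEAR SECOND-ORDER RESIDUAL of row `a`: over the near set, true bond force minus its first-order model at the host bond
`q_b = z₀(e b) − z₀(e a)` in the displacement difference `Δ_b = dev b − dev a` (and `z b − z a = q_b + Δ_b`, `sub_eq_hostBond_add_devDiff`). -/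
noncomputable def nearResid (r : ℝ) {M : ℕ} (z : Fin M → E3) (c : Fin M) {M₀ : ℕ} (z₀ : Fin M₀ → E3) (c₀ : Fin M₀) (e : Fin M → Fin M₀) (a : Fin M) : E3 :=
  ∑ b ∈ nearSet r z c z₀ e a,
    (bondForce (z b - z a) - bondForce (z₀ (e b) - z₀ (e a)) - pairHess (z₀ (e b) - z₀ (e a)) (dev z c z₀ c₀ e b - dev z c z₀ c₀ e a))

/-- The FAR RESIDUAL of row `a`: the true-minus-linearised row force NOT carried by the near second-order residual (exterior of the charted ball, host
partners at distance `≥ r`, cut-off shell mismatch; expanded in §4). -/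
noncomputable def farResid (r : ℝ) {M : ℕ} (z : Fin M → E3) (c : Fin M) {M₀ : ℕ} (z₀ : Fin M₀ → E3) (c₀ : Fin M₀) (e : Fin M → Fin M₀) (a : Fin M) : E3 :=
  (siteForce 7 z a - linForce hessBlk0 force0 z c z₀ c₀ e a) - nearResid r z c z₀ c₀ e a

/-- The row splits as near + far. [formal bookkeeping] -/
theorem row_eq_nearResid_add_farResid (r : ℝ) {M : ℕ} (z : Fin M → E3) (c : Fin M) {M₀ : ℕ} (z₀ : Fin M₀ → E3) (c₀ : Fin M₀) (e : Fin M → Fin M₀)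
    (a : Fin M) : siteForce 7 z a - linForce hessBlk0 force0 z c z₀ c₀ e a = nearResid r z c z₀ c₀ e a + farResid r z c z₀ c₀ e a := by
  rw [farResid]; abel

/-- `z b − z a = q_b + Δ_b`. [formal bookkeeping] -/
theorem sub_eq_hostBond_add_devDiff {M : ℕ} (z : Fin M → E3) (c : Fin M) {M₀ : ℕ} (z₀ : Fin M₀ → E3) (c₀ : Fin M₀) (e : Fin M → Fin M₀) (a b : Fin M) :
    z b - z a = (z₀ (e b) - z₀ (e a)) + (dev z c z₀ c₀ e b - dev z c z₀ c₀ e a) := by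
  simp only [dev]; abel

/-- ★ **(T2) `PairTaylor2 B T s₀ r m`** [KNOWN-MATH · per-bond calculus; PROVED from (C2L) with the closed-form tail in §3] — on the bond shell `s₀ ≤ ‖q‖ < r` and
for `‖Δ‖ ≤ m`, the bond force is its second-order Taylor polynomial at `q` (linear part the tree's `pairHess q`, quadratic part `½ B(q)[Δ,Δ]`) up to the TAIL
`T(‖q‖, ‖Δ‖)`. -/
def PairTaylor2 (B : E3 → E3 →L[ℝ] E3 →L[ℝ] E3) (T : ℝ → ℝ → ℝ) (s₀ r m : ℝ) : Prop :=
  ∀ q Δ : E3, s₀ ≤ ‖q‖ → ‖q‖ < r → ‖Δ‖ ≤ m → ‖bondForce (q + Δ) - bondForce q - pairHess q Δ - (1 / 2 : ℝ) • B q Δ Δ‖ ≤ T ‖q‖ ‖Δ‖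

/-- ★ **(SEP) `HostSep 𝓘 s₀`** [decidable per host] — distinct sites of every instance of the family are at least `s₀` apart. -/
def HostSep (𝓘 : ChartFam) (s₀ : ℝ) : Prop := ∀ (M₀ : ℕ) (z₀ : Fin M₀ → E3) (c₀ : Fin M₀), 𝓘 M₀ z₀ c₀ → ∀ i j : Fin M₀, i ≠ j → s₀ ≤ dist (z₀ i) (z₀ j)

/-- ★ **(FAR) `FarColumn 𝓘 τ r X`** [INSTRUMENTABLE — the slack column X₃ of the census] — on every admissible clean mono-phase `𝓘`-charted cluster (same binders
as `PricedCharge`) the far residual of every reach row is at most `X(z₀)(e a)`. -/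
def FarColumn (𝓘 : ChartFam) (τ r : ℝ) (X : SlackTab) : Prop :=
  ∀ (M : ℕ) (z : Fin M → E3) (c : Fin M) (M₀ : ℕ) (z₀ : Fin M₀ → E3) (c₀ : Fin M₀) (e : Fin M → Fin M₀) (t : ℝ),
    Admissible M z c → CleanBall (63 / 10) z c → MonoPhaseBall (63 / 10) z c → 0 ≤ t → t ≤ constLaw τ M₀ z₀ c₀ → ChartBy 𝓘 τ t z c z₀ c₀ e →
      FineChart τ z c z₀ c₀ e → ∀ a ∈ ball (63 / 10) z c, IsReach z c a → ‖farResid r z c z₀ c₀ e a‖ ≤ X M₀ z₀ c₀ (e a)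

/-- ★ **THE NEAR ESTIMATE**: under (T2) on the near bonds, `‖nearResid‖ ≤ quadPrice B T r` — triangle inequality AFTER summing the quadratic parts as vectors
(the tails are summed in norm). [formal bookkeeping] -/
theorem norm_nearResid_le_quadPrice {B : E3 → E3 →L[ℝ] E3 →L[ℝ] E3} {T : ℝ → ℝ → ℝ} {s₀ r m : ℝ} (hT : PairTaylor2 B T s₀ r m) {M : ℕ} {z : Fin M → E3}
    {c : Fin M} {M₀ : ℕ} {z₀ : Fin M₀ → E3} {c₀ : Fin M₀} {e : Fin M → Fin M₀} {a : Fin M} (hs : ∀ b ∈ nearSet r z c z₀ e a, s₀ ≤ ‖z₀ (e b) - z₀ (e a)‖)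
    (hm : ∀ b ∈ nearSet r z c z₀ e a, ‖dev z c z₀ c₀ e b - dev z c z₀ c₀ e a‖ ≤ m) :
    ‖nearResid r z c z₀ c₀ e a‖ ≤ quadPrice B T r M z c M₀ z₀ c₀ e a := by
  set S := nearSet r z c z₀ e a with hS
  set q : Fin M → E3 := fun b => z₀ (e b) - z₀ (e a) with hq
  set D : Fin M → E3 := fun b => dev z c z₀ c₀ e b - dev z c z₀ c₀ e a with hD
  have hsplit : nearResid r z c z₀ c₀ e a = (1 / 2 : ℝ) • ∑ b ∈ S, B (q b) (D b) (D b) +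
      ∑ b ∈ S, (bondForce (q b + D b) - bondForce (q b) - pairHess (q b) (D b) - (1 / 2 : ℝ) • B (q b) (D b) (D b)) := by
    rw [nearResid, Finset.smul_sum, ← Finset.sum_add_distrib]
    refine Finset.sum_congr rfl fun b _ => ?_
    rw [sub_eq_hostBond_add_devDiff z c z₀ c₀ e a b]
    abel
  have hrem : ∀ b ∈ S, ‖bondForce (q b + D b) - bondForce (q b) - pairHess (q b) (D b) - (1 / 2 : ℝ) • B (q b) (D b) (D b)‖ ≤ T ‖q b‖ ‖D b‖ := by
    intro b hb
    have hr : ‖q b‖ < r := by have := (mem_nearSet.1 hb).2.2; rwa [dist_eq_norm] at this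
    exact hT (q b) (D b) (hs b hb) hr (hm b hb)
  rw [hsplit]
  calc ‖(1 / 2 : ℝ) • ∑ b ∈ S, B (q b) (D b) (D b) + ∑ b ∈ S, (bondForce (q b + D b) - bondForce (q b) - pairHess (q b) (D b) - (1 / 2 : ℝ) • B (q b) (D b) (D b))‖
        ≤ ‖(1 / 2 : ℝ) • ∑ b ∈ S, B (q b) (D b) (D b)‖ + ∑ b ∈ S, ‖bondForce (q b + D b) - bondForce (q b) - pairHess (q b) (D b) - (1 / 2 : ℝ) • B (q b) (D b) (D b)‖ :=
          (norm_add_le _ _).trans (by gcongr; exact norm_sum_le _ _)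
    _ ≤ ‖(1 / 2 : ℝ) • ∑ b ∈ S, B (q b) (D b) (D b)‖ + ∑ b ∈ S, T ‖q b‖ ‖D b‖ := by gcongr with b hb; exact hrem b hb
    _ = quadPrice B T r M z c M₀ z₀ c₀ e a := by simp only [quadPrice, hS, hq, hD, nearSet]

/-- ★★★ **THE SEAM — the quadratic-price law from per-bond Taylor, host separation and the far column**:
`PairTaylor2 B T s₀ r (2τ) ∧ HostSep 𝓘 s₀ ∧ FarColumn 𝓘 τ r X ⟹ PricedCharge 𝓘 τ (quadPrice B T r) X`. [formal bookkeeping: the ChartBy injectivity clause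
separates the host images of distinct near sites, FineChart bounds `‖Δ_b‖ ≤ 2τ`, the row is near + far] -/
theorem pricedCharge_quadPrice_of_pairTaylor2 {𝓘 : ChartFam} {τ s₀ r : ℝ} {B : E3 → E3 →L[ℝ] E3 →L[ℝ] E3} {T : ℝ → ℝ → ℝ} {X : SlackTab}
    (hT : PairTaylor2 B T s₀ r (2 * τ)) (hsep : HostSep 𝓘 s₀) (hX : FarColumn 𝓘 τ r X) : PricedCharge 𝓘 τ (quadPrice B T r) X := by
  intro M z c M₀ z₀ c₀ e t hz hcl hm ht htT hch hf a ha hr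
  rw [row_eq_nearResid_add_farResid r]
  refine (norm_add_le _ _).trans (add_le_add ?_ (hX M z c M₀ z₀ c₀ e t hz hcl hm ht htT hch hf a ha hr))
  refine norm_nearResid_le_quadPrice hT (fun b hb => ?_) (fun b hb => ?_)
  · obtain ⟨hbB, hba, -⟩ := mem_nearSet.1 hb
    rw [← dist_eq_norm]
    refine hsep M₀ z₀ c₀ hch.1 (e b) (e a) fun hE => hba ?_
    exact hch.2.2.2.2.1 b a (mem_ball.1 hbB) (mem_ball.1 ha) hE
  · obtain ⟨hbB, -, -⟩ := mem_nearSet.1 hb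
    calc ‖dev z c z₀ c₀ e b - dev z c z₀ c₀ e a‖ ≤ ‖dev z c z₀ c₀ e b‖ + ‖dev z c z₀ c₀ e a‖ := norm_sub_le _ _
      _ ≤ τ + τ := add_le_add (hf b (mem_ball.1 hbB)) (hf a (mem_ball.1 ha))
      _ = 2 * τ := by ring

/-! ## §3. The per-bond law from second-derivative data: the closed-form cubic tail -/

/-- The CLOSED-FORM TAIL TABLE of record: `cubicTail L s μ = L(s)·μ³/6` (the census tabulates the Hessian-Lipschitz modulus `L(s)` of the bond force per shell). -/
noncomputable def cubicTail (L : ℝ → ℝ) (s μ : ℝ) : ℝ := L s * μ ^ 3 / 6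

/-- ★ **(C2L) `BondHessLip B L s₀ r m`** [KNOWN-MATH — explicit calculus of the rational map `f(x) = (V'(‖x‖)/‖x‖)·x` on the shell; `L` INSTRUMENTABLE] — for every
host bond `q` of the shell `s₀ ≤ ‖q‖ < r` and every `‖Δ‖ ≤ m`, along the segment `t ↦ q + tΔ` (`t ∈ [0,1]`): `bondForce` has derivative `pairHess`, `pairHess` has
derivative `B`, and `‖B(q + tΔ) − B(q)‖ ≤ L(‖q‖)·t·‖Δ‖`. -/
def BondHessLip (B : E3 → E3 →L[ℝ] E3 →L[ℝ] E3) (L : ℝ → ℝ) (s₀ r m : ℝ) : Prop :=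
  ∀ q Δ : E3, s₀ ≤ ‖q‖ → ‖q‖ < r → ‖Δ‖ ≤ m → ∀ t ∈ Icc (0 : ℝ) 1,
    HasFDerivAt bondForce (pairHess (q + t • Δ)) (q + t • Δ) ∧ HasFDerivAt pairHess (B (q + t • Δ)) (q + t • Δ) ∧
      ‖B (q + t • Δ) - B q‖ ≤ L ‖q‖ * (t * ‖Δ‖)

/-- ★★ **(C2L) ⟹ (T2) with the cubic tail** (§1 applied bond by bond). [elementary] -/
theorem pairTaylor2_of_bondHessLip {B : E3 → E3 →L[ℝ] E3 →L[ℝ] E3} {L : ℝ → ℝ} {s₀ r m : ℝ} (h : BondHessLip B L s₀ r m) :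
    PairTaylor2 B (cubicTail L) s₀ r m := fun q Δ hs hr hΔ => by
  rw [cubicTail]
  exact norm_taylor_two_segment_le (fun t ht => (h q Δ hs hr hΔ t ht).1) (fun t ht => (h q Δ hs hr hΔ t ht).2.1)
    (fun t ht => (h q Δ hs hr hΔ t (Ico_subset_Icc_self ht)).2.2)

/-- ★★★ **THE DISCHARGED LAW**: `BondHessLip B L s₀ r (2τ) ∧ HostSep 𝓘 s₀ ∧ FarColumn 𝓘 τ r X ⟹ PricedCharge 𝓘 τ (quadPrice B (cubicTail L) r) X`. -/
theorem pricedCharge_quadPrice_of_bondHessLip {𝓘 : ChartFam} {τ s₀ r : ℝ} {B : E3 → E3 →L[ℝ] E3 →L[ℝ] E3} {L : ℝ → ℝ} {X : SlackTab}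
    (hC : BondHessLip B L s₀ r (2 * τ)) (hsep : HostSep 𝓘 s₀) (hX : FarColumn 𝓘 τ r X) : PricedCharge 𝓘 τ (quadPrice B (cubicTail L) r) X :=
  pricedCharge_quadPrice_of_pairTaylor2 (pairTaylor2_of_bondHessLip hC) hsep hX

/-- ★★★ **THE T-LEAF RECORD AFTER g73** — `[CORE-FAR]` from: the cover, the per-bond second-derivative data (C2L) at `m = 2τ`, host separation, the far column,
the box top, the finite table of polytope steps and the certificate at `k n` (g72's `coreOff_of_quadPrice_descent` with the law discharged). [formal bookkeeping] -/
theorem coreOff_of_bondHessLip_descent {𝓘 : ChartFam} {τ s₀ r : ℝ} {B : E3 → E3 →L[ℝ] E3 →L[ℝ] E3} {L : ℝ → ℝ} {X : SlackTab} (k : ℕ → ℝ) (n : ℕ)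
    (hτ : 0 ≤ τ) (hcov : FamilyCover 𝓘 (24 / 5) (1 / 100) (1 / 8) τ) (hC : BondHessLip B L s₀ r (2 * τ)) (hsep : HostSep 𝓘 s₀) (hX : FarColumn 𝓘 τ r X)
    (h0 : PriceTop 𝓘 τ (quadPrice B (cubicTail L) r) (k 0 * sigmaOne))
    (hs : ∀ i : ℕ, i < n → PriceStep 𝓘 τ sigmaOne (quadPrice B (cubicTail L) r) hessBlk0 force0 X (k i) (k (i + 1) * sigmaOne))
    (hcert : SlackCert 𝓘 τ (k n) sigmaOne hessBlk0 force0 X) : CoreOffTubeFloor (63 / 10) (63 / 10) (24 / 5) (1 / 100) 0 :=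
  coreOff_of_quadPrice_descent k n hτ (pricedCharge_quadPrice_of_bondHessLip hC hsep hX) h0 hs hcert hcov

/-! ## §4. The far residual EXPANDED: exterior bonds, un-charted host partners, far Hessian columns (what the slack column must dominate) -/

/-- Membership in the move-test neighbourhood. [formal bookkeeping] -/
theorem mem_moveNbrs_iff {Rm : ℝ} {N : ℕ} {y : Fin N → E3} {j k : Fin N} : k ∈ moveNbrs Rm y j ↔ k ≠ j ∧ dist (y k) (y j) ≤ Rm := by
  simp [moveNbrs, Finset.mem_filter, Finset.mem_erase]

/-- `pairHess` is EVEN: `∇²V(‖−x‖) = ∇²V(‖x‖)`. [formal bookkeeping] -/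
theorem pairHess_neg (x : E3) : pairHess (-x) = pairHess x := by
  ext h
  simp [pairHess, norm_neg, neg_smul, smul_neg]

/-- The EXTERIOR FORCE of row `a`: true bond forces from move-test neighbours OUTSIDE the near set (sites beyond the charted ball, charted partners at host
distance `≥ r`). -/
noncomputable def exteriorForce (r : ℝ) {M : ℕ} (z : Fin M → E3) (c : Fin M) {M₀ : ℕ} (z₀ : Fin M₀ → E3) (e : Fin M → Fin M₀) (a : Fin M) : E3 :=
  ∑ k ∈ moveNbrs 7 z a \ nearSet r z c z₀ e a, bondForce (z k - z a)

/-- The UN-CHARTED HOST PART of row `a`: constant + diagonal model terms of the host move-test partners of `e a` that are NOT images of near sites. -/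
noncomputable def hostFar (r : ℝ) {M : ℕ} (z : Fin M → E3) (c : Fin M) {M₀ : ℕ} (z₀ : Fin M₀ → E3) (c₀ : Fin M₀) (e : Fin M → Fin M₀) (a : Fin M) : E3 :=
  ∑ k₀ ∈ moveNbrs 7 z₀ (e a) \ (nearSet r z c z₀ e a).image e, (bondForce (z₀ k₀ - z₀ (e a)) - pairHess (z₀ (e a) - z₀ k₀) (dev z c z₀ c₀ e a))

/-- The FAR HESSIAN COLUMNS of row `a`: the linear model's column terms at the charted ball sites `a' ≠ a` outside the near set (`pairHess` for host move-test
partners at distance `≥ r`, zero otherwise). -/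
noncomputable def colFar (r : ℝ) {M : ℕ} (z : Fin M → E3) (c : Fin M) {M₀ : ℕ} (z₀ : Fin M₀ → E3) (c₀ : Fin M₀) (e : Fin M → Fin M₀) (a : Fin M) : E3 :=
  ∑ a' ∈ (ball (63 / 10) z c).erase a \ nearSet r z c z₀ e a, hessBlk0 M₀ z₀ c₀ (e a) (e a') (dev z c z₀ c₀ e a')

/-- ★★ **THE FAR RESIDUAL EXPANDED** — with `e` injective on the charted ball (ChartBy), `a` in the ball, `r ≤ 7`, and the near sites inside the move-test radius:
`farResid = exteriorForce − hostFar − colFar`.  (The near host bonds cancel EXACTLY against the model: `f(q_b) + pairHess(q_b) Δ_b` is the model's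
constant + diagonal + column contribution of partner `e b`, by evenness of `pairHess`.) [formal bookkeeping] -/
theorem farResid_eq {r : ℝ} {M : ℕ} {z : Fin M → E3} {c : Fin M} {M₀ : ℕ} {z₀ : Fin M₀ → E3} {c₀ : Fin M₀} {e : Fin M → Fin M₀} {a : Fin M}
    (hinj : ∀ b b', b ∈ ball (63 / 10) z c → b' ∈ ball (63 / 10) z c → e b = e b' → b = b') (ha : a ∈ ball (63 / 10) z c) (hr : r ≤ 7)
    (h7 : ∀ b ∈ nearSet r z c z₀ e a, dist (z b) (z a) ≤ 7) :
    farResid r z c z₀ c₀ e a = exteriorForce r z c z₀ e a - hostFar r z c z₀ c₀ e a - colFar r z c z₀ c₀ e a := by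
  set S := nearSet r z c z₀ e a with hS
  -- the three inclusions
  have hne : ∀ b ∈ S, e b ≠ e a := fun b hb hE =>
    (mem_nearSet.1 hb).2.1 (hinj b a (mem_nearSet.1 hb).1 ha hE)
  have hSN : S ⊆ moveNbrs 7 z a := fun b hb => mem_moveNbrs_iff.2 ⟨(mem_nearSet.1 hb).2.1, h7 b hb⟩
  have hSB : S ⊆ (ball (63 / 10) z c).erase a := fun b hb => Finset.mem_erase.2 ⟨(mem_nearSet.1 hb).2.1, (mem_nearSet.1 hb).1⟩
  have hinjS : Set.InjOn e ↑S := fun b hb b' hb' hE =>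
    hinj b b' (mem_nearSet.1 (Finset.mem_coe.1 hb)).1 (mem_nearSet.1 (Finset.mem_coe.1 hb')).1 hE
  have hmemN₀ : ∀ b ∈ S, e b ∈ moveNbrs 7 z₀ (e a) := fun b hb =>
    mem_moveNbrs_iff.2 ⟨hne b hb, ((mem_nearSet.1 hb).2.2).le.trans hr⟩
  have hIN : S.image e ⊆ moveNbrs 7 z₀ (e a) := fun k₀ hk => by
    obtain ⟨b, hb, rfl⟩ := Finset.mem_image.1 hk
    exact hmemN₀ b hb
  -- (1) the true force: near + exterior
  have h1 : siteForce 7 z a = ∑ b ∈ S, bondForce (z b - z a) + exteriorForce r z c z₀ e a := by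
    rw [siteForce_eq_sum_bondForce, exteriorForce, ← hS, ← Finset.sum_sdiff hSN, add_comm]
  -- (2) the host force: near images + un-charted partners
  have h2 : force0 M₀ z₀ c₀ (e a) =
      ∑ b ∈ S, bondForce (z₀ (e b) - z₀ (e a)) + ∑ k₀ ∈ moveNbrs 7 z₀ (e a) \ S.image e, bondForce (z₀ k₀ - z₀ (e a)) := by
    simp only [force0]
    rw [siteForce_eq_sum_bondForce, ← Finset.sum_sdiff hIN, Finset.sum_image hinjS, add_comm]
  -- (3) the Hessian row: diagonal + near columns + far columns
  have h3 : ∑ a' ∈ ball (63 / 10) z c, hessBlk0 M₀ z₀ c₀ (e a) (e a') (dev z c z₀ c₀ e a') =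
      hessBlk0 M₀ z₀ c₀ (e a) (e a) (dev z c z₀ c₀ e a) + ∑ b ∈ S, hessBlk0 M₀ z₀ c₀ (e a) (e b) (dev z c z₀ c₀ e b) + colFar r z c z₀ c₀ e a := by
    rw [← Finset.add_sum_erase _ _ ha, ← Finset.sum_sdiff hSB, colFar, ← hS]
    abel
  have hdiag : hessBlk0 M₀ z₀ c₀ (e a) (e a) (dev z c z₀ c₀ e a) = -(∑ b ∈ S, pairHess (z₀ (e b) - z₀ (e a)) (dev z c z₀ c₀ e a)) -
      ∑ k₀ ∈ moveNbrs 7 z₀ (e a) \ S.image e, pairHess (z₀ (e a) - z₀ k₀) (dev z c z₀ c₀ e a) := by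
    rw [show hessBlk0 M₀ z₀ c₀ (e a) (e a) = -∑ k ∈ moveNbrs 7 z₀ (e a), pairHess (z₀ (e a) - z₀ k) by simp [hessBlk0]]
    rw [neg_apply, sum_apply, ← Finset.sum_sdiff hIN, Finset.sum_image hinjS]
    have : ∀ b ∈ S, pairHess (z₀ (e a) - z₀ (e b)) (dev z c z₀ c₀ e a) = pairHess (z₀ (e b) - z₀ (e a)) (dev z c z₀ c₀ e a) := fun b _ => by
      rw [← neg_sub (z₀ (e b)), pairHess_neg]
    rw [Finset.sum_congr rfl this]
    abel
  have hcol : ∀ b ∈ S, hessBlk0 M₀ z₀ c₀ (e a) (e b) (dev z c z₀ c₀ e b) = pairHess (z₀ (e b) - z₀ (e a)) (dev z c z₀ c₀ e b) := fun b hb => by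
    rw [show hessBlk0 M₀ z₀ c₀ (e a) (e b) = pairHess (z₀ (e a) - z₀ (e b)) by simp [hessBlk0, hne b hb, hmemN₀ b hb]]
    rw [← neg_sub (z₀ (e b)), pairHess_neg]
  -- assemble
  rw [farResid, nearResid, ← hS, linForce, h1, h2, h3, hdiag, Finset.sum_congr rfl hcol, hostFar, ← hS, Finset.sum_sub_distrib,
    Finset.sum_sub_distrib, Finset.sum_sub_distrib]
  simp only [map_sub]
  rw [Finset.sum_sub_distrib]
  abel

/-- Under the fine clause and `r + 2τ ≤ 7` the near sites ARE move-test neighbours. [formal bookkeeping] -/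
theorem dist_le_seven_of_mem_nearSet {τ r : ℝ} (hr : r + 2 * τ ≤ 7) {M : ℕ} {z : Fin M → E3} {c : Fin M} {M₀ : ℕ} {z₀ : Fin M₀ → E3} {c₀ : Fin M₀}
    {e : Fin M → Fin M₀} (hf : FineChart τ z c z₀ c₀ e) {a b : Fin M} (ha : a ∈ ball (63 / 10) z c) (hb : b ∈ nearSet r z c z₀ e a) :
    dist (z b) (z a) ≤ 7 := by
  obtain ⟨hbB, -, hd⟩ := mem_nearSet.1 hb
  rw [dist_eq_norm, sub_eq_hostBond_add_devDiff z c z₀ c₀ e a b]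
  calc ‖z₀ (e b) - z₀ (e a) + (dev z c z₀ c₀ e b - dev z c z₀ c₀ e a)‖
        ≤ ‖z₀ (e b) - z₀ (e a)‖ + (‖dev z c z₀ c₀ e b‖ + ‖dev z c z₀ c₀ e a‖) := (norm_add_le _ _).trans (by gcongr; exact norm_sub_le _ _)
    _ ≤ r + (τ + τ) := by
          rw [← dist_eq_norm]
          exact add_le_add hd.le (add_le_add (hf b (mem_ball.1 hbB)) (hf a (mem_ball.1 ha)))
    _ ≤ 7 := by linarith

/-- ★★ **THE FAR COLUMN FROM THREE NAMED BOUNDS** (the census's X₃ obligation, typed): if on every charted admissible cluster and every reach row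
`‖exteriorForce‖ + ‖hostFar‖ + ‖colFar‖ ≤ X(z₀)(e a)`, and `r + 2τ ≤ 7`, then `FarColumn 𝓘 τ r X`. [formal bookkeeping over `farResid_eq`] -/
theorem farColumn_of_pieces {𝓘 : ChartFam} {τ r : ℝ} {X : SlackTab} (hr : r + 2 * τ ≤ 7) (hτ : 0 ≤ τ)
    (h : ∀ (M : ℕ) (z : Fin M → E3) (c : Fin M) (M₀ : ℕ) (z₀ : Fin M₀ → E3) (c₀ : Fin M₀) (e : Fin M → Fin M₀) (t : ℝ),
      Admissible M z c → CleanBall (63 / 10) z c → MonoPhaseBall (63 / 10) z c → 0 ≤ t → t ≤ constLaw τ M₀ z₀ c₀ → ChartBy 𝓘 τ t z c z₀ c₀ e →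
        FineChart τ z c z₀ c₀ e → ∀ a ∈ ball (63 / 10) z c, IsReach z c a →
          ‖exteriorForce r z c z₀ e a‖ + ‖hostFar r z c z₀ c₀ e a‖ + ‖colFar r z c z₀ c₀ e a‖ ≤ X M₀ z₀ c₀ (e a)) :
    FarColumn 𝓘 τ r X := by
  intro M z c M₀ z₀ c₀ e t hz hcl hm ht htT hch hf a ha hrch
  have hinj : ∀ b b', b ∈ ball (63 / 10) z c → b' ∈ ball (63 / 10) z c → e b = e b' → b = b' := fun b b' hb hb' hE =>
    hch.2.2.2.2.1 b b' (mem_ball.1 hb) (mem_ball.1 hb') hE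
  rw [farResid_eq hinj ha (by linarith) fun b hb => dist_le_seven_of_mem_nearSet hr hf ha hb]
  calc ‖exteriorForce r z c z₀ e a - hostFar r z c z₀ c₀ e a - colFar r z c z₀ c₀ e a‖
        ≤ ‖exteriorForce r z c z₀ e a‖ + ‖hostFar r z c z₀ c₀ e a‖ + ‖colFar r z c z₀ c₀ e a‖ :=
          (norm_sub_le _ _).trans (by gcongr; exact norm_sub_le _ _)
    _ ≤ X M₀ z₀ c₀ (e a) := h M z c M₀ z₀ c₀ e t hz hcl hm ht htT hch hf a ha hrch

end Summit.AtomisticToContinuum.Crystallization.Theorems.FrustratedLawDichotomyStrainedPatchTaylorCharge
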